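import Mathlib
import Summits.NavierStokesRegularity.NavierStokesRegularity.Theorems.PlaneEnergyCeilingPlanarEnergyAPrioriDecayPressureSource
import Literature.Analysis.FluidPDE.NormalisedPressureFarField
import Summits.NavierStokesRegularity.NavierStokesRegularity.Theorems.RellichScarScarRigidityApexRegularityTimeLemmas

/-!
# Route PlaneEnergyCeiling · crux `PlanarEnergyAPriori` — decay persistence, pressure part (2):
# spatial decay of the normalised (Riesz) pressure of a decaying divergence-free field

Helper file for the crux item stmt-NavierStokesRegularity-16855 (`PlanarEnergyAPriori`, route
`PlaneEnergyCeiling`), landed `--supports` that item, on the proof path of the registered stub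
`stub_decayPersistence` of the line `birth` (the pressure clauses
`(1 + |x|)² (|p - π₀(s)| + |∇p|) ≤ C₀`). For a divergence-free field `w ∈ C³(ℝ³; ℝ³)` whose
derivatives of orders `≤ 3` carry the cubic weight, `(1 + |y|)³ ‖Dᵏw(y)‖ ≤ C`, the normalised
pressure `p̃[w] = -Δ⁻¹∂ᵢ∂ⱼ(wᵢwⱼ)` (tree: `normalisedPressure`, realised through the pressure
potential `Q[w] = -Q₁[w] - Q₂[w]` of `PressureRepresentation`) satisfies

  `(1 + |x|)² (|p̃[w](x)| + ‖∇p̃[w](x)‖) ≤ K C²`   (`exists_decay_normalisedPressure`),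

with an absolute constant `K`, from the source bounds of the companion file
(`…DecayPressureSource`: `|G[w]|, ‖∇G[w]‖ = O(C² (1+|y|)⁻⁶)`):
* the NEAR potential `Q₁[w] = Γ₀ * G[w]` (`Γ₀` the Newtonian kernel cut off at radius `2`,
  `∫|Γ₀| < ∞`) inherits `O((1+|x|)⁻⁶)`, and `∇Q₁ = Γ₀ * ∇G` (`fderiv_integral_smul_comp_sub_apply`);
* the FAR potential `Q₂[w](x) = ∫ D²Γ∞(x-y)(w y, w y) dy` and `∇Q₂ = ∫ D³Γ∞(x-y)(·, w y, w y)`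
  (`fderiv_farPotential_apply`) are `O((1+|x|)⁻²)`: the kernels decay like `(1+|z|)⁻³`
  (`exists_hasDecay_fderiv_newtonFar`), and Peetre's inequality
  `(1+|x-y|)⁻²(1+|y|)⁻² ≤ (1+|x|)⁻²` leaves the integrable `(1+|y|)⁻⁴`.

References: T. Tao, Anal. PDE 6 (2013), (35), (42), Lemma 4.1; D. Gilbarg, N. Trudinger,
Lemma 4.2; L. Brandolese, Math. Ann. 329 (2004) (the `|x|⁻³` pressure decay). All [folklore].
-/

noncomputable section

-- single-conjunct summit: `Summit.<Summit>.<Problem>` repeats the name by the D-0017 layout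
set_option linter.dupNamespace false

namespace Summit.NavierStokesRegularity.NavierStokesRegularity.Theorems.PlanarEnergyAPriori

open MeasureTheory Set Filter Topology Function Metric Real InnerProductSpace
open scoped ENNReal NNReal RealInnerProductSpace
open Literature.Analysis.FluidPDE

section Potentials

-- nested operator types `ℝ³ →L[ℝ] ℝ³ →L[ℝ] ℝ³ →L[ℝ] ℝ` (as in `PressureRepresentation`)
set_option maxSynthPendingDepth 3

open Literature.Analysis.FluidPDE.PineauVicol2026 (exists_hasDecay_fderiv_newtonFar)

variable {w : EuclideanSpace ℝ (Fin 3) → EuclideanSpace ℝ (Fin 3)} {C : ℝ}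

/-- `|w|² ∈ L¹` under the cubic weight. [folklore] -/
theorem integrable_norm_sq_of_weight (hw : Continuous w) (hC : 0 ≤ C)
    (hk : ∀ k ≤ 3, ∀ y, (1 + ‖y‖) ^ 3 * ‖iteratedFDeriv ℝ k w y‖ ≤ C) :
    Integrable fun y => ‖w y‖ ^ 2 := by
  refine Integrable.mono' (RellichScarScarRigidity.integrable_inv_one_add_norm_pow_four.const_mul (C ^ 2))
    (hw.norm.pow 2).aestronglyMeasurable (Eventually.of_forall fun y => ?_)
  rw [Real.norm_eq_abs, abs_of_nonneg (by positivity), sq]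
  have h := norm_iteratedFDeriv_mul_le_of_weight hC hk (Nat.zero_le 3) (Nat.zero_le 3) y
  rw [norm_iteratedFDeriv_zero] at h
  have h64 : ((1 + ‖y‖) ^ 6)⁻¹ ≤ ((1 + ‖y‖) ^ 4)⁻¹ :=
    inv_anti₀ (by positivity) (pow_le_pow_right₀ (by linarith [norm_nonneg y]) (by norm_num))
  exact h.trans (mul_le_mul_of_nonneg_left h64 (by positivity))

/-! #### The near potential -/

/-- **Decay of the near potential**: `|Q₁[w](x)| ≤ (∫|Γ₀|) · 4374 C² ((1+|x|)⁶)⁻¹`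
(`Γ₀ = newtonNear 1 2` vanishes off `‖z‖ ≤ 2`, where `|G[w](x-z)| ≤ 6·729 C² ((1+|x|)⁶)⁻¹`).
[folklore] -/
theorem abs_nearPotential_le_of_decay (hw : ContDiff ℝ 3 w) (hdiv : VectorCalculus.IsDivFree w)
    (hC : 0 ≤ C) (hk : ∀ k ≤ 3, ∀ y, (1 + ‖y‖) ^ 3 * ‖iteratedFDeriv ℝ k w y‖ ≤ C)
    (x : EuclideanSpace ℝ (Fin 3)) :
    |nearPotential 1 2 w x| ≤ (∫ z, ‖newtonNear 1 2 z‖) * (4374 * C ^ 2 * ((1 + ‖x‖) ^ 6)⁻¹) := by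
  set B : ℝ := 4374 * C ^ 2 * ((1 + ‖x‖) ^ 6)⁻¹ with hB
  have hB0 : 0 ≤ B := by positivity
  have hkint : Integrable (newtonNear 1 2) := integrable_newtonNear zero_le_one one_lt_two
  rw [nearPotential, ← Real.norm_eq_abs, ← integral_mul_const]
  refine norm_integral_le_of_norm_le (hkint.norm.mul_const B) (Eventually.of_forall fun z => ?_)
  rw [norm_mul]
  rcases le_or_gt ‖z‖ 2 with hz | hz
  · refine mul_le_mul_of_nonneg_left ?_ (norm_nonneg _)
    rw [Real.norm_eq_abs]
    calc |pressureSource w (x - z)| ≤ 6 * C ^ 2 * ((1 + ‖x - z‖) ^ 6)⁻¹ :=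
          abs_pressureSource_le_of_decay hw hdiv hC hk _
      _ ≤ 6 * C ^ 2 * (729 * ((1 + ‖x‖) ^ 6)⁻¹) := by
          gcongr; exact inv_one_add_norm_sub_pow_six_le hz
      _ = B := by rw [hB]; ring
  · rw [newtonNear_eq_zero zero_le_one one_lt_two hz.le, norm_zero, zero_mul, zero_mul]

/-- **Decay of the gradient of the near potential**:
`‖∇Q₁[w](x)‖ ≤ (∫|Γ₀|) · 8748 C² ((1+|x|)⁶)⁻¹` (`∇Q₁ = Γ₀ * ∇G`). [folklore] -/
theorem norm_fderiv_nearPotential_le_of_decay (hw : ContDiff ℝ 3 w)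
    (hdiv : VectorCalculus.IsDivFree w) (hC : 0 ≤ C)
    (hk : ∀ k ≤ 3, ∀ y, (1 + ‖y‖) ^ 3 * ‖iteratedFDeriv ℝ k w y‖ ≤ C)
    (x : EuclideanSpace ℝ (Fin 3)) :
    ‖fderiv ℝ (nearPotential 1 2 w) x‖ ≤
      (∫ z, ‖newtonNear 1 2 z‖) * (8748 * C ^ 2 * ((1 + ‖x‖) ^ 6)⁻¹) := by
  set B : ℝ := 8748 * C ^ 2 * ((1 + ‖x‖) ^ 6)⁻¹ with hB
  have hB0 : 0 ≤ B := by positivity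
  have hkint : Integrable (newtonNear 1 2) := integrable_newtonNear zero_le_one one_lt_two
  have hN0 : 0 ≤ ∫ z, ‖newtonNear 1 2 z‖ := integral_nonneg fun z => norm_nonneg _
  have hG1 : ContDiff ℝ 1 (pressureSource w) := contDiff_pressureSource (by exact_mod_cast hw)
  have hkρ : ∀ z : EuclideanSpace ℝ (Fin 3), (2 : ℝ) < ‖z‖ → newtonNear 1 2 z = 0 := fun z hz =>
    newtonNear_eq_zero zero_le_one one_lt_two hz.le
  have hfun : nearPotential 1 2 w = fun x => ∫ z, newtonNear 1 2 z • pressureSource w (x - z) := rfl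
  refine ContinuousLinearMap.opNorm_le_bound _ (mul_nonneg hN0 hB0) fun a => ?_
  rw [hfun, fderiv_integral_smul_comp_sub_apply hkint hkρ hG1 x a, ← integral_mul_const,
    ← integral_mul_const]
  refine norm_integral_le_of_norm_le ((hkint.norm.mul_const B).mul_const ‖a‖)
    (Eventually.of_forall fun z => ?_)
  rw [norm_smul]
  rcases le_or_gt ‖z‖ 2 with hz | hz
  · rw [mul_assoc]
    refine mul_le_mul_of_nonneg_left ?_ (norm_nonneg _)
    calc ‖fderiv ℝ (pressureSource w) (x - z) a‖
        ≤ ‖fderiv ℝ (pressureSource w) (x - z)‖ * ‖a‖ := ContinuousLinearMap.le_opNorm _ _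
      _ ≤ (12 * C ^ 2 * ((1 + ‖x - z‖) ^ 6)⁻¹) * ‖a‖ := by
          gcongr; exact norm_fderiv_pressureSource_le_of_decay hw hdiv hC hk _
      _ ≤ (12 * C ^ 2 * (729 * ((1 + ‖x‖) ^ 6)⁻¹)) * ‖a‖ := by
          gcongr; exact inv_one_add_norm_sub_pow_six_le hz
      _ = B * ‖a‖ := by rw [hB]; ring
  · rw [hkρ z hz, norm_zero, zero_mul, zero_mul, zero_mul]

/-! #### The far potential -/

open Literature.Analysis.FluidPDE.FourierNS in
/-- **Decay of the far potential**: `|Q₂[w](x)| ≤ M C² I₄ ((1+|x|)²)⁻¹` whenever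
`‖D²Γ∞(z)‖ ≤ M ((1+|z|)³)⁻¹` (`I₄ = ∫ ((1+|y|)⁴)⁻¹`; Peetre). [folklore] -/
theorem abs_farPotential_le_of_decay (hC : 0 ≤ C)
    (hk : ∀ k ≤ 3, ∀ y, (1 + ‖y‖) ^ 3 * ‖iteratedFDeriv ℝ k w y‖ ≤ C) {M : ℝ}
    (hM : HasDecay 3 M (fderiv ℝ (fderiv ℝ (newtonFar 1 2)))) (x : EuclideanSpace ℝ (Fin 3)) :
    |farPotential 1 2 w x| ≤
      M * C ^ 2 * (∫ y : EuclideanSpace ℝ (Fin 3), ((1 + ‖y‖) ^ 4)⁻¹) * ((1 + ‖x‖) ^ 2)⁻¹ := by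
  have hM0 : 0 ≤ M := hM.nonneg
  set g : EuclideanSpace ℝ (Fin 3) → ℝ := fun y =>
    (M * C ^ 2 * ((1 + ‖x‖) ^ 2)⁻¹) * ((1 + ‖y‖) ^ 4)⁻¹ with hg
  have hgi : Integrable g := RellichScarScarRigidity.integrable_inv_one_add_norm_pow_four.const_mul _
  rw [farPotential, ← Real.norm_eq_abs]
  refine (norm_integral_le_of_norm_le hgi (Eventually.of_forall fun y => ?_)).trans (le_of_eq ?_)
  · have hw2 : ‖w y‖ * ‖w y‖ ≤ C ^ 2 * ((1 + ‖y‖) ^ 6)⁻¹ := by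
      have h := norm_iteratedFDeriv_mul_le_of_weight hC hk (Nat.zero_le 3) (Nat.zero_le 3) y
      rwa [norm_iteratedFDeriv_zero] at h
    calc ‖fderiv ℝ (fderiv ℝ (newtonFar 1 2)) (x - y) (w y) (w y)‖
        ≤ ‖fderiv ℝ (fderiv ℝ (newtonFar 1 2)) (x - y) (w y)‖ * ‖w y‖ :=
          ContinuousLinearMap.le_opNorm _ _
      _ ≤ ‖fderiv ℝ (fderiv ℝ (newtonFar 1 2)) (x - y)‖ * ‖w y‖ * ‖w y‖ := by
          gcongr; exact ContinuousLinearMap.le_opNorm _ _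
      _ ≤ M * ((1 + ‖x - y‖) ^ 3)⁻¹ * (C ^ 2 * ((1 + ‖y‖) ^ 6)⁻¹) := by
          rw [mul_assoc]
          exact mul_le_mul (hM _) hw2 (by positivity) (by positivity)
      _ = M * C ^ 2 * (((1 + ‖x - y‖) ^ 3)⁻¹ * ((1 + ‖y‖) ^ 6)⁻¹) := by ring
      _ ≤ M * C ^ 2 * (((1 + ‖x‖) ^ 2)⁻¹ * ((1 + ‖y‖) ^ 4)⁻¹) :=
          mul_le_mul_of_nonneg_left (far_weight_le x y) (by positivity)
      _ = g y := by rw [hg]; ring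
  · rw [hg, integral_const_mul]; ring

open Literature.Analysis.FluidPDE.FourierNS in
/-- **Decay of the gradient of the far potential**: `‖∇Q₂[w](x)‖ ≤ M C² I₄ ((1+|x|)²)⁻¹`
whenever `‖D³Γ∞(z)‖ ≤ M ((1+|z|)³)⁻¹` (`∇Q₂ = ∫ D³Γ∞(x-y)(·, w y, w y)`). [folklore] -/
theorem norm_fderiv_farPotential_le_of_decay (hwc : Continuous w) (hC : 0 ≤ C)
    (hk : ∀ k ≤ 3, ∀ y, (1 + ‖y‖) ^ 3 * ‖iteratedFDeriv ℝ k w y‖ ≤ C) {M : ℝ}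
    (hM : HasDecay 3 M (fderiv ℝ (fderiv ℝ (fderiv ℝ (newtonFar 1 2)))))
    (x : EuclideanSpace ℝ (Fin 3)) :
    ‖fderiv ℝ (farPotential 1 2 w) x‖ ≤
      M * C ^ 2 * (∫ y : EuclideanSpace ℝ (Fin 3), ((1 + ‖y‖) ^ 4)⁻¹) * ((1 + ‖x‖) ^ 2)⁻¹ := by
  have hM0 : 0 ≤ M := hM.nonneg
  have hI0 : 0 ≤ ∫ y : EuclideanSpace ℝ (Fin 3), ((1 + ‖y‖) ^ 4)⁻¹ :=
    integral_nonneg fun y => by positivity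
  have hL2 : Integrable fun y => ‖w y‖ ^ 2 := integrable_norm_sq_of_weight hwc hC hk
  refine ContinuousLinearMap.opNorm_le_bound _ (by positivity) fun a => ?_
  rw [fderiv_farPotential_apply one_pos one_lt_two hwc hL2 x a]
  set g : EuclideanSpace ℝ (Fin 3) → ℝ := fun y =>
    (M * C ^ 2 * ((1 + ‖x‖) ^ 2)⁻¹ * ‖a‖) * ((1 + ‖y‖) ^ 4)⁻¹ with hg
  have hgi : Integrable g := RellichScarScarRigidity.integrable_inv_one_add_norm_pow_four.const_mul _
  refine (norm_integral_le_of_norm_le hgi (Eventually.of_forall fun y => ?_)).trans (le_of_eq ?_)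
  · have hw2 : ‖w y‖ * ‖w y‖ ≤ C ^ 2 * ((1 + ‖y‖) ^ 6)⁻¹ := by
      have h := norm_iteratedFDeriv_mul_le_of_weight hC hk (Nat.zero_le 3) (Nat.zero_le 3) y
      rwa [norm_iteratedFDeriv_zero] at h
    calc ‖fderiv ℝ (fderiv ℝ (fderiv ℝ (newtonFar 1 2))) (x - y) a (w y) (w y)‖
        ≤ ‖fderiv ℝ (fderiv ℝ (fderiv ℝ (newtonFar 1 2))) (x - y) a (w y)‖ * ‖w y‖ :=
          ContinuousLinearMap.le_opNorm _ _
      _ ≤ ‖fderiv ℝ (fderiv ℝ (fderiv ℝ (newtonFar 1 2))) (x - y) a‖ * ‖w y‖ * ‖w y‖ := by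
          gcongr; exact ContinuousLinearMap.le_opNorm _ _
      _ ≤ ‖fderiv ℝ (fderiv ℝ (fderiv ℝ (newtonFar 1 2))) (x - y)‖ * ‖a‖ * ‖w y‖ * ‖w y‖ := by
          gcongr; exact ContinuousLinearMap.le_opNorm _ _
      _ = (‖fderiv ℝ (fderiv ℝ (fderiv ℝ (newtonFar 1 2))) (x - y)‖ * ‖a‖) * (‖w y‖ * ‖w y‖) := by
          ring
      _ ≤ (M * ((1 + ‖x - y‖) ^ 3)⁻¹ * ‖a‖) * (C ^ 2 * ((1 + ‖y‖) ^ 6)⁻¹) :=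
          mul_le_mul (by gcongr; exact hM _) hw2 (by positivity) (by positivity)
      _ = M * C ^ 2 * ‖a‖ * (((1 + ‖x - y‖) ^ 3)⁻¹ * ((1 + ‖y‖) ^ 6)⁻¹) := by ring
      _ ≤ M * C ^ 2 * ‖a‖ * (((1 + ‖x‖) ^ 2)⁻¹ * ((1 + ‖y‖) ^ 4)⁻¹) :=
          mul_le_mul_of_nonneg_left (far_weight_le x y) (by positivity)
      _ = g y := by rw [hg]; ring
  · rw [hg, integral_const_mul]; ring

/-! #### The normalised pressure -/

/-- **Spatial decay of the normalised pressure and its gradient under cubic decay of the field.**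
There is an absolute constant `K ≥ 0` such that for every divergence-free `w ∈ C³(ℝ³; ℝ³)`
with `(1 + |y|)³ ‖Dᵏw(y)‖ ≤ C` for `k ≤ 3` (`C ≥ 0`):
`(1 + |x|)² |p̃[w](x)| ≤ K C²` and `(1 + |x|)² ‖∇p̃[w](x)‖ ≤ K C²` for all `x`
(`p̃ = normalisedPressure = -Q₁ - Q₂`; near and far estimates above). [folklore] -/
theorem exists_decay_normalisedPressure :
    ∃ K : ℝ, 0 ≤ K ∧ ∀ (w : EuclideanSpace ℝ (Fin 3) → EuclideanSpace ℝ (Fin 3)) (C : ℝ), 0 ≤ C →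
      ContDiff ℝ 3 w → Literature.Analysis.FluidPDE.VectorCalculus.IsDivFree w →
      (∀ k ≤ 3, ∀ y, (1 + ‖y‖) ^ 3 * ‖iteratedFDeriv ℝ k w y‖ ≤ C) →
      ∀ x, (1 + ‖x‖) ^ 2 * |Literature.Analysis.FluidPDE.normalisedPressure w x| ≤ K * C ^ 2 ∧
        (1 + ‖x‖) ^ 2 * ‖fderiv ℝ (Literature.Analysis.FluidPDE.normalisedPressure w) x‖ ≤
          K * C ^ 2 := by
  obtain ⟨⟨M₂, hM₂⟩, ⟨M₃, hM₃⟩, -⟩ := exists_hasDecay_fderiv_newtonFar one_pos one_lt_two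
  set N₁ : ℝ := ∫ z, ‖newtonNear 1 2 z‖ with hN₁
  set I₄ : ℝ := ∫ y : EuclideanSpace ℝ (Fin 3), ((1 + ‖y‖) ^ 4)⁻¹ with hI₄
  have hN0 : 0 ≤ N₁ := integral_nonneg fun z => norm_nonneg _
  have hI0 : 0 ≤ I₄ := integral_nonneg fun y => by positivity
  have hM₂0 : 0 ≤ M₂ := hM₂.nonneg
  have hM₃0 : 0 ≤ M₃ := hM₃.nonneg
  refine ⟨N₁ * 4374 + M₂ * I₄ + (N₁ * 8748 + M₃ * I₄), by positivity,
    fun w C hC hw hdiv hk x => ?_⟩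
  have hwc : Continuous w := hw.continuous
  have hw2 : ContDiff ℝ 2 w := hw.of_le (by norm_num)
  have hL2 : Integrable fun y => ‖w y‖ ^ 2 := integrable_norm_sq_of_weight hwc hC hk
  have hrepr : normalisedPressure w = pressurePotential w :=
    normalisedPressure_eq_pressurePotential' hw2 hL2
  have hpos2 : 0 < (1 + ‖x‖) ^ 2 := by positivity
  have hW62 : ((1 + ‖x‖) ^ 6)⁻¹ ≤ ((1 + ‖x‖) ^ 2)⁻¹ :=
    inv_anti₀ hpos2 (pow_le_pow_right₀ (by simp) (by norm_num))
  have hkey : (1 + ‖x‖) ^ 2 * ((1 + ‖x‖) ^ 2)⁻¹ = 1 := mul_inv_cancel₀ hpos2.ne'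
  -- the value
  have hval : |pressurePotential w x| ≤ (N₁ * 4374 + M₂ * I₄) * C ^ 2 * ((1 + ‖x‖) ^ 2)⁻¹ := by
    have h1 := abs_nearPotential_le_of_decay hw hdiv hC hk x
    have h2 := abs_farPotential_le_of_decay hC hk hM₂ x
    rw [pressurePotential]
    calc |-nearPotential 1 2 w x - farPotential 1 2 w x|
        ≤ |nearPotential 1 2 w x| + |farPotential 1 2 w x| := by
          have := abs_sub (-nearPotential 1 2 w x) (farPotential 1 2 w x)
          rwa [abs_neg] at this
      _ ≤ N₁ * (4374 * C ^ 2 * ((1 + ‖x‖) ^ 6)⁻¹) + M₂ * C ^ 2 * I₄ * ((1 + ‖x‖) ^ 2)⁻¹ :=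
          add_le_add h1 h2
      _ ≤ N₁ * (4374 * C ^ 2 * ((1 + ‖x‖) ^ 2)⁻¹) + M₂ * C ^ 2 * I₄ * ((1 + ‖x‖) ^ 2)⁻¹ := by
          gcongr
      _ = (N₁ * 4374 + M₂ * I₄) * C ^ 2 * ((1 + ‖x‖) ^ 2)⁻¹ := by ring
  -- the gradient
  have hQ₁ : Differentiable ℝ (nearPotential 1 2 w) :=
    (contDiff_nearPotential zero_le_one one_lt_two 1 (by exact_mod_cast hw)).differentiable
      (by norm_num)
  have hQ₂ : Differentiable ℝ (farPotential 1 2 w) :=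
    (contDiff_farPotential one_pos one_lt_two hwc hL2).1.differentiable two_ne_zero
  have hgrad : ‖fderiv ℝ (pressurePotential w) x‖ ≤
      (N₁ * 8748 + M₃ * I₄) * C ^ 2 * ((1 + ‖x‖) ^ 2)⁻¹ := by
    have hfun : pressurePotential w = fun x => -nearPotential 1 2 w x - farPotential 1 2 w x := rfl
    have hd : HasFDerivAt (fun y => -nearPotential 1 2 w y - farPotential 1 2 w y)
        (-fderiv ℝ (nearPotential 1 2 w) x - fderiv ℝ (farPotential 1 2 w) x) x :=
      ((hQ₁ x).hasFDerivAt.neg).sub (hQ₂ x).hasFDerivAt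
    rw [hfun, hd.fderiv]
    have h1 := norm_fderiv_nearPotential_le_of_decay hw hdiv hC hk x
    have h2 := norm_fderiv_farPotential_le_of_decay hwc hC hk hM₃ x
    calc ‖-fderiv ℝ (nearPotential 1 2 w) x - fderiv ℝ (farPotential 1 2 w) x‖
        ≤ ‖fderiv ℝ (nearPotential 1 2 w) x‖ + ‖fderiv ℝ (farPotential 1 2 w) x‖ := by
          have := norm_sub_le (-fderiv ℝ (nearPotential 1 2 w) x) (fderiv ℝ (farPotential 1 2 w) x)
          rwa [norm_neg] at this
      _ ≤ N₁ * (8748 * C ^ 2 * ((1 + ‖x‖) ^ 6)⁻¹) + M₃ * C ^ 2 * I₄ * ((1 + ‖x‖) ^ 2)⁻¹ :=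
          add_le_add h1 h2
      _ ≤ N₁ * (8748 * C ^ 2 * ((1 + ‖x‖) ^ 2)⁻¹) + M₃ * C ^ 2 * I₄ * ((1 + ‖x‖) ^ 2)⁻¹ := by
          gcongr
      _ = (N₁ * 8748 + M₃ * I₄) * C ^ 2 * ((1 + ‖x‖) ^ 2)⁻¹ := by ring
  rw [hrepr]
  constructor
  · calc (1 + ‖x‖) ^ 2 * |pressurePotential w x|
        ≤ (1 + ‖x‖) ^ 2 * ((N₁ * 4374 + M₂ * I₄) * C ^ 2 * ((1 + ‖x‖) ^ 2)⁻¹) := by gcongr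
      _ = (N₁ * 4374 + M₂ * I₄) * C ^ 2 * ((1 + ‖x‖) ^ 2 * ((1 + ‖x‖) ^ 2)⁻¹) := by ring
      _ = (N₁ * 4374 + M₂ * I₄) * C ^ 2 := by rw [hkey, mul_one]
      _ ≤ (N₁ * 4374 + M₂ * I₄ + (N₁ * 8748 + M₃ * I₄)) * C ^ 2 :=
          mul_le_mul_of_nonneg_right (le_add_of_nonneg_right (by positivity)) (by positivity)
  · calc (1 + ‖x‖) ^ 2 * ‖fderiv ℝ (pressurePotential w) x‖
        ≤ (1 + ‖x‖) ^ 2 * ((N₁ * 8748 + M₃ * I₄) * C ^ 2 * ((1 + ‖x‖) ^ 2)⁻¹) := by gcongr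
      _ = (N₁ * 8748 + M₃ * I₄) * C ^ 2 * ((1 + ‖x‖) ^ 2 * ((1 + ‖x‖) ^ 2)⁻¹) := by ring
      _ = (N₁ * 8748 + M₃ * I₄) * C ^ 2 := by rw [hkey, mul_one]
      _ ≤ (N₁ * 4374 + M₂ * I₄ + (N₁ * 8748 + M₃ * I₄)) * C ^ 2 :=
          mul_le_mul_of_nonneg_right (le_add_of_nonneg_left (by positivity)) (by positivity)

end Potentials

end Summit.NavierStokesRegularity.NavierStokesRegularity.Theorems.PlanarEnergyAPriori

end
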